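import Literature.NumberTheory.Automorphic.UnitaryGroupRestrictedProduct
import Literature.NumberTheory.Automorphic.UnitaryGroupArchimedean
import HarnessLib

/-!
# `U(J)(𝔸_F) ≃ U(J)(E ⊗ ℝ) × U(J)(𝔸_{F,f})`: the archimedean × finite-adelic decomposition

Registry: pub-hodgecm MODEL-CONSTRUCTION sub-cell, MODEL-DAG node **U2** (v). Companion of
`UnitaryGroupLocalFactors` / `UnitaryGroupRestrictedProduct` / `UnitaryGroupArchimedean` (U2-i/ii/iii).

For a quadratic extension `E/F` of number fields with `c ∈ Gal(E/F)` and a matrix `J ∈ M_N(E)`, the adelic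
points `U(J)(𝔸_F) ≤ GL_N(𝔸_E) = GL_N(E_∞ × 𝔸_E^∞)` (`UnitaryGroup.adelic`) decompose as the direct product of the
archimedean group `U(J)(E ⊗ ℝ)` (`UnitaryGroup.arch`, a closed subgroup of `GL_N(ℝ^{r₁} × ℂ^{r₂})`) and the
finite-adelic group `U(J)(𝔸_{F,f})` (`UnitaryGroup.finAdelic`):

* `UnitaryGroup.sndHom_mem_finAdelic` / `toMixed_mem_arch`: the finite and archimedean components of an adelic
  point of `U(J)` are points of `U(J)`; `mem_adelic_iff_toMixed_sndHom`: `g ∈ U(J)(𝔸_F)` iff both components are;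
* the component homomorphisms `archPart : U(J)(𝔸_F) →* U(J)(E ⊗ ℝ)` and `finPart : U(J)(𝔸_F) →* U(J)(𝔸_{F,f})`
  (continuous; retractions of `archToAdelic`, `finAdelicToAdelic`; the two embedded factors commute);
* **`UnitaryGroup.adelicProdEquiv : U(J)(𝔸_F) ≃ₜ* U(J)(E ⊗ ℝ) × U(J)(𝔸_{F,f})`** as topological groups, whence
  with U2-ii's `finAdelicEquiv` the full factorisation `U(J)(𝔸_F) ≅ U(J)(E ⊗ ℝ) × ∏'_v U(J)(F_v)`;
* consequences for the theta / Godement setting: for a CM extension and a totally definite `J` the archimedean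
  factor is compact (`isCompact_arch_cm`, U2-iii), so `U(J)(𝔸_F)/U(J)(𝔸_{F,f})`-type statements reduce to the
  finite-adelic group; recorded here as `isCompact_range_archToAdelic`.

Everything is elementary bookkeeping over the tree's `GLn.toMixed` / `GLn.sndHom` / `GLn.ofInfinite` / `GLn.ofFinite`
(`AdelicGLnGlue`, `GLnAdelicStructure`: `GLn.ofInfinite_toMixed_mul_ofFinite_sndHom`, `GLn.commute_ofInfinite_ofFinite`)
and proved; no published theorem is cited as a hypothesis. References: Borel–Jacquet, Corvallis 1979, §4.1
(`G(𝔸) = G_∞ × G(𝔸_f)`); Platonov–Rapinchuk 1994, §5.1.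
-/

noncomputable section

open NumberField IsDedekindDomain Topology

open scoped Matrix MatrixGroups ComplexOrder

namespace Literature.NumberTheory.Automorphic

namespace UnitaryGroup

open NumberField.mixedEmbedding

variable (F E : Type) [Field F] [NumberField F] [Field E] [NumberField E] [Algebra F E]
  (c : E ≃ₐ[F] E) (N : ℕ) (J : Matrix (Fin N) (Fin N) E)

/-! ## 1. Components of adelic points -/

omit [NumberField F] in
/-- **The finite component of a point of `U(J)(𝔸_F)` lies in `U(J)(𝔸_{F,f})`** (project the defining identity
`(c g)ᵀ J g = J` over `𝔸_E = E_∞ × 𝔸_E^∞` to the second factor). Borel–Jacquet 1979, §4.1. [cite: BorelJacquet1979, §4.1] -/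
theorem sndHom_mem_finAdelic (G : GL (Fin N) (AdeleRing (𝓞 E) E)) (hG : G ∈ adelic F E c N J) :
    GLn.sndHom N E G ∈ finAdelic F E c N J := by
  rw [adelic, mem_unitaryGroupOfForm_iff] at hG
  rw [mem_finAdelic_iff]
  have hsnd : (G : Matrix (Fin N) (Fin N) (AdeleRing (𝓞 E) E)).map (adeleSnd E) =
      ((GLn.sndHom N E G : GL (Fin N) (FiniteAdeleRing (𝓞 E) E)) : Matrix (Fin N) (Fin N) _) := rfl
  have hσsnd : ((G : Matrix (Fin N) (Fin N) (AdeleRing (𝓞 E) E)).map (conjAdele F E c)).map (adeleSnd E) =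
      ((GLn.sndHom N E G : GL (Fin N) (FiniteAdeleRing (𝓞 E) E)) : Matrix (Fin N) (Fin N) _).map
        (conjFiniteAdele F E c) := by
    rw [Matrix.map_map,
      show (adeleSnd E ∘ conjAdele F E c : AdeleRing (𝓞 E) E → FiniteAdeleRing (𝓞 E) E) =
        (conjFiniteAdele F E c) ∘ adeleSnd E from rfl,
      ← Matrix.map_map, hsnd]
  have hJsnd : (adelicForm E N J).map (adeleSnd E) = finiteAdelicForm E N J := by
    rw [adelicForm, finiteAdelicForm, Matrix.map_map]; rfl
  have key := congrArg (fun M : Matrix (Fin N) (Fin N) (AdeleRing (𝓞 E) E) => M.map (adeleSnd E)) hG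
  simp only [Matrix.map_mul, Matrix.transpose_map] at key
  rw [hσsnd, hsnd, hJsnd] at key
  exact key

omit [NumberField F] in
/-- **The archimedean component of a point of `U(J)(𝔸_F)` lies in `U(J)(E ⊗ ℝ)`**: `g_∞ = g · (1, g_f)⁻¹` in
`GL_N(𝔸_E)` and both factors are in `U(J)(𝔸_F)`. Borel–Jacquet 1979, §4.1. [cite: BorelJacquet1979, §4.1] -/
theorem toMixed_mem_arch (G : GL (Fin N) (AdeleRing (𝓞 E) E)) (hG : G ∈ adelic F E c N J) :
    GLn.toMixed N E G ∈ arch F E c N J := by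
  have h1 : GLn.ofFinite N E (GLn.sndHom N E G) ∈ adelic F E c N J :=
    (ofFinite_mem_adelic_iff F E c N J _).2 (sndHom_mem_finAdelic F E c N J G hG)
  have h2 : GLn.ofInfinite N E (GLn.toMixed N E G) = G * (GLn.ofFinite N E (GLn.sndHom N E G))⁻¹ := by
    rw [eq_mul_inv_iff_mul_eq, GLn.ofInfinite_toMixed_mul_ofFinite_sndHom]
  rw [← ofInfinite_mem_adelic_iff, h2]
  exact mul_mem hG (inv_mem h1)

omit [NumberField F] in
/-- **`g ∈ U(J)(𝔸_F)` iff its archimedean component lies in `U(J)(E ⊗ ℝ)` and its finite component in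
`U(J)(𝔸_{F,f})`.** Borel–Jacquet 1979, §4.1. [cite: BorelJacquet1979, §4.1] -/
theorem mem_adelic_iff_toMixed_sndHom (G : GL (Fin N) (AdeleRing (𝓞 E) E)) :
    G ∈ adelic F E c N J ↔ GLn.toMixed N E G ∈ arch F E c N J ∧ GLn.sndHom N E G ∈ finAdelic F E c N J := by
  refine ⟨fun h => ⟨toMixed_mem_arch F E c N J G h, sndHom_mem_finAdelic F E c N J G h⟩, fun h => ?_⟩
  rw [← GLn.ofInfinite_toMixed_mul_ofFinite_sndHom (n := N) (K := E) G]
  exact mul_mem ((ofInfinite_mem_adelic_iff F E c N J _).2 h.1) ((ofFinite_mem_adelic_iff F E c N J _).2 h.2)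

/-! ## 2. The component homomorphisms -/

/-- **The archimedean component `U(J)(𝔸_F) →* U(J)(E ⊗ ℝ)`, `g ↦ g_∞`** (restriction of the tree's `GLn.toMixed`).
[cite: BorelJacquet1979, §4.1] -/
def archPart : (adelicGroupData F E c N J).Adelic →* arch F E c N J :=
  ((GLn.toMixed N E).comp (adelicVal F E c N J)).codRestrict (arch F E c N J)
    fun g => toMixed_mem_arch F E c N J _ g.2

/-- **The finite component `U(J)(𝔸_F) →* U(J)(𝔸_{F,f})`, `g ↦ g_f`** (restriction of the tree's `GLn.sndHom`).
[cite: BorelJacquet1979, §4.1] -/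
def finPart : (adelicGroupData F E c N J).Adelic →* finAdelic F E c N J :=
  ((GLn.sndHom N E).comp (adelicVal F E c N J)).codRestrict (finAdelic F E c N J)
    fun g => sndHom_mem_finAdelic F E c N J _ g.2

/-- `archPart g = g_∞` in `GL_N(E ⊗ ℝ)`. [folklore] -/
@[simp] theorem coe_archPart (g : (adelicGroupData F E c N J).Adelic) :
    ((archPart F E c N J g : arch F E c N J) : GL (Fin N) (mixedSpace E)) = GLn.toMixed N E (adelicVal F E c N J g) :=
  rfl

/-- `finPart g = g_f` in `GL_N(𝔸_E^∞)`. [folklore] -/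
@[simp] theorem coe_finPart (g : (adelicGroupData F E c N J).Adelic) :
    ((finPart F E c N J g : finAdelic F E c N J) : GL (Fin N) (FiniteAdeleRing (𝓞 E) E)) =
      GLn.sndHom N E (adelicVal F E c N J g) :=
  rfl

/-- `archPart` is continuous. [folklore] -/
theorem continuous_archPart : Continuous (archPart F E c N J) :=
  ((GLn.continuous_toMixed N E).comp continuous_subtype_val).subtype_mk _

/-- `finPart` is continuous. [folklore] -/
theorem continuous_finPart : Continuous (finPart F E c N J) :=
  ((continuous_snd.generalLinearGroup_map :
      Continuous (GLn.sndHom N E)).comp continuous_subtype_val).subtype_mk _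

/-- `(g_∞, 1)_∞ = g_∞`. [folklore] -/
@[simp] theorem archPart_archToAdelic (a : arch F E c N J) :
    archPart F E c N J (archToAdelic F E c N J a) = a :=
  Subtype.ext (GLn.toMixed_ofInfinite (n := N) (K := E) a.1)

/-- `(1, g_f)_∞ = 1`. [folklore] -/
@[simp] theorem archPart_finAdelicToAdelic (b : finAdelic F E c N J) :
    archPart F E c N J (finAdelicToAdelic F E c N J b) = 1 :=
  Subtype.ext (GLn.toMixed_ofFinite (n := N) (K := E) b.1)

/-- `(g_∞, 1)_f = 1`. [folklore] -/
@[simp] theorem finPart_archToAdelic (a : arch F E c N J) :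
    finPart F E c N J (archToAdelic F E c N J a) = 1 :=
  Subtype.ext (GLn.sndHom_ofInfinite (n := N) (K := E) a.1)

/-- `(1, g_f)_f = g_f`. [folklore] -/
@[simp] theorem finPart_finAdelicToAdelic (b : finAdelic F E c N J) :
    finPart F E c N J (finAdelicToAdelic F E c N J b) = b :=
  Subtype.ext (GLn.sndHom_ofFinite (n := N) (K := E) b.1)

/-- **`g = (g_∞, 1) · (1, g_f)`** in `U(J)(𝔸_F)`. Borel–Jacquet 1979, §4.1. [cite: BorelJacquet1979, §4.1] -/
theorem archToAdelic_mul_finAdelicToAdelic (g : (adelicGroupData F E c N J).Adelic) :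
    archToAdelic F E c N J (archPart F E c N J g) * finAdelicToAdelic F E c N J (finPart F E c N J g) = g :=
  Subtype.ext (GLn.ofInfinite_toMixed_mul_ofFinite_sndHom (n := N) (K := E) _)

/-- **The archimedean and finite factors commute** inside `U(J)(𝔸_F)`. [folklore] -/
theorem commute_archToAdelic_finAdelicToAdelic (a : arch F E c N J) (b : finAdelic F E c N J) :
    Commute (archToAdelic F E c N J a) (finAdelicToAdelic F E c N J b) := by
  rw [Commute, SemiconjBy]
  exact Subtype.ext (GLn.commute_ofInfinite_ofFinite (n := N) (K := E) a.1 b.1).eq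

/-! ## 3. The decomposition `U(J)(𝔸_F) ≃ₜ* U(J)(E ⊗ ℝ) × U(J)(𝔸_{F,f})` -/

/-- **`U(J)(𝔸_F) ≃ₜ* U(J)(E ⊗ ℝ) × U(J)(𝔸_{F,f})` as topological groups**: `g ↦ (g_∞, g_f)` with inverse
`(a, b) ↦ (a, 1) · (1, b)`. Borel–Jacquet 1979, §4.1 (`G(𝔸) = G_∞ × G(𝔸_f)`). [cite: BorelJacquet1979, §4.1] -/
def adelicProdEquiv : (adelicGroupData F E c N J).Adelic ≃ₜ* arch F E c N J × finAdelic F E c N J where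
  toFun g := (archPart F E c N J g, finPart F E c N J g)
  invFun p := archToAdelic F E c N J p.1 * finAdelicToAdelic F E c N J p.2
  left_inv g := archToAdelic_mul_finAdelicToAdelic F E c N J g
  right_inv p := by
    refine Prod.ext ?_ ?_
    · simp only [map_mul, archPart_archToAdelic, archPart_finAdelicToAdelic, mul_one]
    · simp only [map_mul, finPart_archToAdelic, finPart_finAdelicToAdelic, one_mul]
  map_mul' g h := Prod.ext (map_mul _ g h) (map_mul _ g h)
  continuous_toFun := (continuous_archPart F E c N J).prodMk (continuous_finPart F E c N J)
  continuous_invFun :=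
    ((continuous_archToAdelic F E c N J).comp continuous_fst).mul
      ((continuous_finAdelicToAdelic F E c N J).comp continuous_snd)

/-- `adelicProdEquiv g = (g_∞, g_f)`. [folklore] -/
@[simp] theorem adelicProdEquiv_apply (g : (adelicGroupData F E c N J).Adelic) :
    adelicProdEquiv F E c N J g = (archPart F E c N J g, finPart F E c N J g) := rfl

/-- `adelicProdEquiv.symm (a, b) = (a, 1) · (1, b)`. [folklore] -/
@[simp] theorem adelicProdEquiv_symm_apply (p : arch F E c N J × finAdelic F E c N J) :
    (adelicProdEquiv F E c N J).symm p = archToAdelic F E c N J p.1 * finAdelicToAdelic F E c N J p.2 := rfl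

/-- `archPart` is surjective (it has the section `archToAdelic`). [folklore] -/
theorem archPart_surjective : Function.Surjective (archPart F E c N J) :=
  fun a => ⟨archToAdelic F E c N J a, archPart_archToAdelic F E c N J a⟩

/-- `finPart` is surjective (it has the section `finAdelicToAdelic`). [folklore] -/
theorem finPart_surjective : Function.Surjective (finPart F E c N J) :=
  fun b => ⟨finAdelicToAdelic F E c N J b, finPart_finAdelicToAdelic F E c N J b⟩

/-- The kernel of `finPart` is the image of the archimedean group. [folklore] -/
theorem ker_finPart : (finPart F E c N J).ker = (archToAdelic F E c N J).range := by
  ext g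
  constructor
  · intro hg
    refine ⟨archPart F E c N J g, ?_⟩
    have h := archToAdelic_mul_finAdelicToAdelic F E c N J g
    rw [MonoidHom.mem_ker] at hg
    rwa [hg, map_one, mul_one] at h
  · rintro ⟨a, rfl⟩
    rw [MonoidHom.mem_ker, finPart_archToAdelic]

/-- The kernel of `archPart` is the image of the finite-adelic group (the tree's `finiteAdelic`). [folklore] -/
theorem ker_archPart : (archPart F E c N J).ker = finiteAdelic F E c N J := by
  rw [← range_finAdelicToAdelic]
  ext g
  constructor
  · intro hg
    refine ⟨finPart F E c N J g, ?_⟩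
    have h := archToAdelic_mul_finAdelicToAdelic F E c N J g
    rw [MonoidHom.mem_ker] at hg
    rwa [hg, map_one, one_mul] at h
  · rintro ⟨b, rfl⟩
    rw [MonoidHom.mem_ker, archPart_finAdelicToAdelic]

/-! ## 4. The CM / totally definite case: compact archimedean factor -/

/-- For a compact archimedean group `U(J)(E ⊗ ℝ)` (e.g. `J` totally definite over a CM extension,
`isCompact_arch_cm`), the archimedean factor `U(J)(E ⊗ ℝ) × {1} ≤ U(J)(𝔸_F)` is compact. [folklore] -/
theorem isCompact_range_archToAdelic (h : IsCompact (arch F E c N J : Set (GL (Fin N) (mixedSpace E)))) :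
    IsCompact ((archToAdelic F E c N J).range : Set (adelicGroupData F E c N J).Adelic) := by
  have : CompactSpace (arch F E c N J) := isCompact_iff_compactSpace.mp h
  rw [MonoidHom.coe_range]
  exact isCompact_range (continuous_archToAdelic F E c N J)

section CM

variable (L : Type) [Field L] [NumberField L] [IsCMField L] (H : Matrix (Fin N) (Fin N) L)

/-- **CM, totally definite case**: for `F = L⁺`, `E = L` CM, `c` = complex conjugation and `H` definite (of either
sign) at every complex place, `U(H)(𝔸_{L⁺}) ≃ₜ* U(H)(L ⊗ ℝ) × U(H)(𝔸_{L⁺,f})` with COMPACT first factor. [folklore] -/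
theorem isCompact_range_archToAdelic_cm
    (hdef : ∀ w : {w : InfinitePlace L // w.IsComplex}, (H.map w.1.embedding).PosDef ∨ (-H.map w.1.embedding).PosDef) :
    IsCompact ((archToAdelic (↥(maximalRealSubfield L)) L (IsCMField.complexConj L) N H).range :
      Set (adelicGroupData (↥(maximalRealSubfield L)) L (IsCMField.complexConj L) N H).Adelic) :=
  isCompact_range_archToAdelic _ L _ N H (isCompact_arch_cm N L H hdef)

end CM

end UnitaryGroup

end Literature.NumberTheory.Automorphic

end
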